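import Literature.Analysis.Complex.LaguerrePolya
import HarnessLib

/-!
# Growth of even real-rooted entire functions from the 2-jet at `0` (file XVIII-a)

Handoff track (ROUTE 1′), seat handoff-theory-1 gen16 (placement of idea-3 gen22's ROUTE R-K
«COUNT ∧ THIN ⟹ RH»; continued in `HandoffThinRigidity.lean`, file XVIII-b). Pure complex analysis,
RH-free, no definitions. MAIN RESULT `log_norm_sub_le_of_im_ne_zero`: for `F` entire of order `< 2`,
EVEN, with only real zeros and `F 0 ≠ 0`, and `Im z ≠ 0`,
`log ‖F z‖ − log ‖F 0‖ ≤ −Re((F′/F)′(0))/2 · ‖z‖²` — the Laguerre–Pólya growth bound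
`‖F(z)‖ ≤ ‖F(0)‖ exp(Σ ‖z‖²/aₖ²)` WITHOUT Hadamard's product: Titchmarsh's Lemma α
(`Literature.Analysis.Complex.titchmarsh_logDeriv_sub_sum`) on `|w| < R` gives
`F′/F = Σ_{|a| ≤ R} m(a)/(w − a) + ψ_R`, `‖ψ_R′‖ ≪ R^{ρ−2}`; its ODD part is
`Σ m(a) w/(w² − a²) + ψ_R^{odd}`; along `[0, z]` each pair term contributes
`(m/2) log ‖1 − z²/a²‖ ≤ m ‖z‖²/(2a²)` and `Σ m(a)/a² = −Re(F′/F)′(0) + O(‖ψ_R′‖)`; let `R → ∞`.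
(Pólya 1913; Levin, *Distribution of zeros of entire functions*, Ch. VIII.) Nothing here bears on RH.
-/

set_option linter.dupNamespace false

noncomputable section

open Filter Set Topology Metric Complex
open scoped ComplexConjugate Real

namespace Summit.RiemannHypothesis.RiemannHypothesis.Theorems

namespace ThinRigidity

open Literature.Analysis.Complex

/-! ## §0 Calculus helpers: the derivative of `s ↦ log ‖φ s‖` -/

/-- `d/ds log ‖φ(s)‖ = Re (φ′(s)/φ(s))` at a point where `φ(s) ≠ 0`. -/
theorem hasDerivAt_log_norm {φ : ℝ → ℂ} {φ' : ℂ} {s : ℝ} (h : HasDerivAt φ φ' s)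
    (h0 : φ s ≠ 0) : HasDerivAt (fun s => Real.log ‖φ s‖) ((φ' / φ s).re) s := by
  have hpos : 0 < ‖φ s‖ ^ 2 := by positivity
  have h1 : HasDerivAt (fun s => ‖φ s‖ ^ 2) (2 * @inner ℝ ℂ _ (φ s) φ') s := h.norm_sq
  have h2 : HasDerivAt (fun s => Real.log (‖φ s‖ ^ 2)) ((2 * @inner ℝ ℂ _ (φ s) φ') / (‖φ s‖ ^ 2)) s :=
    h1.log hpos.ne'
  have h3 : (fun s => Real.log ‖φ s‖) = fun s => Real.log (‖φ s‖ ^ 2) / 2 := by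
    funext s; rw [Real.log_pow]; push_cast; ring
  rw [h3]
  refine (h2.div_const 2).congr_deriv ?_
  rw [Complex.inner, Complex.div_re, Complex.normSq_eq_norm_sq]
  have : (φ' * conj (φ s)).re = φ'.re * (φ s).re + φ'.im * (φ s).im := by
    simp [Complex.mul_re, Complex.conj_re, Complex.conj_im]; try ring
  rw [this]; field_simp; try ring

/-- Along the segment `s ↦ s • z`: `d/ds log ‖F(s z)‖ = Re (z F′(s z)/F(s z))`. -/
theorem hasDerivAt_log_norm_comp_smul {F : ℂ → ℂ} (hF : Differentiable ℂ F) (z : ℂ) {s : ℝ}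
    (h0 : F ((s : ℂ) * z) ≠ 0) :
    HasDerivAt (fun s : ℝ => Real.log ‖F ((s : ℂ) * z)‖)
      ((z * (deriv F ((s : ℂ) * z) / F ((s : ℂ) * z))).re) s := by
  have hφ : HasDerivAt (fun s : ℝ => F ((s : ℂ) * z)) (deriv F ((s : ℂ) * z) * z) s := by
    have h1 : HasDerivAt (fun w : ℂ => F (w * z)) (deriv F ((s : ℂ) * z) * z) (s : ℂ) := by
      have hi : HasDerivAt (fun w : ℂ => w * z) z (s : ℂ) := by
        simpa using (hasDerivAt_id (s : ℂ)).mul_const z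
      exact (hF _).hasDerivAt.comp (s : ℂ) hi
    exact h1.comp_ofReal
  refine (hasDerivAt_log_norm hφ h0).congr_deriv ?_
  congr 1; field_simp

/-- `d/ds (m/2) log ‖(s z)² − b‖ = Re (m s z²/((s z)² − b))` where `(s z)² ≠ b`. -/
theorem hasDerivAt_log_norm_sq_sub (z b : ℂ) (m : ℝ) {s : ℝ}
    (h0 : ((s : ℂ) * z) ^ 2 - b ≠ 0) :
    HasDerivAt (fun s : ℝ => m / 2 * Real.log ‖((s : ℂ) * z) ^ 2 - b‖)
      (((m : ℂ) * ((s : ℂ) * z ^ 2) / (((s : ℂ) * z) ^ 2 - b)).re) s := by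
  have hφ : HasDerivAt (fun s : ℝ => ((s : ℂ) * z) ^ 2 - b) (2 * ((s : ℂ) * z) * z) s := by
    have h1 : HasDerivAt (fun w : ℂ => (w * z) ^ 2 - b) (2 * ((s : ℂ) * z) * z) (s : ℂ) := by
      have hi : HasDerivAt (fun w : ℂ => w * z) z (s : ℂ) := by
        simpa using (hasDerivAt_id (s : ℂ)).mul_const z
      simpa using (hi.pow 2).sub_const b
    exact h1.comp_ofReal
  have h := (hasDerivAt_log_norm hφ h0).const_mul (m / 2)
  refine h.congr_deriv ?_
  rw [← Complex.re_ofReal_mul]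
  congr 1; push_cast; field_simp; try ring

/-! ## §1 Growth of even real-rooted entire functions of order `< 2` from the 2-jet at `0` -/

section Growth

variable {F : ℂ → ℂ}

/-- For an even `F`, `deriv F` is odd. -/
theorem deriv_neg_of_even (heven : ∀ z, F (-z) = F z) (w : ℂ) : deriv F (-w) = -deriv F w := by
  have := deriv_comp_neg F w
  rw [show (fun z => F (-z)) = F from funext heven] at this
  linear_combination this

/-- For an even `F`, `deriv F 0 = 0`. -/
theorem deriv_zero_of_even (heven : ∀ z, F (-z) = F z) : deriv F 0 = 0 := by
  have := deriv_neg_of_even heven 0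
  rw [neg_zero] at this; linear_combination this / 2

/-- For an even `F` with `F 0 ≠ 0`, the derivative of the logarithmic derivative at `0` is
`F″(0)/F(0)`. -/
theorem deriv_logDeriv_zero_of_even (hF : Differentiable ℂ F) (heven : ∀ z, F (-z) = F z)
    (h0 : F 0 ≠ 0) :
    deriv (fun w => deriv F w / F w) 0 = deriv (deriv F) 0 / F 0 := by
  have hd : Differentiable ℂ (deriv F) := fun w =>
    ((hF.differentiableOn.analyticOnNhd isOpen_univ).deriv w (mem_univ w)).differentiableAt
  have h : HasDerivAt (fun w => deriv F w / F w)
      ((deriv (deriv F) 0 * F 0 - deriv F 0 * deriv F 0) / F 0 ^ 2) 0 :=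
    (hd 0).hasDerivAt.div (hF 0).hasDerivAt h0
  rw [h.deriv, deriv_zero_of_even heven]; field_simp; ring

/-- A zero of an even function with only real zeros and `F 0 ≠ 0` is a non-zero real number. -/
theorem zero_re_ne_zero (hzero : ∀ z, F z = 0 → z.im = 0)
    (h0 : F 0 ≠ 0) {a : ℂ} (ha : F a = 0) : a = (a.re : ℂ) ∧ a.re ≠ 0 := by
  have him := hzero a ha
  refine ⟨Complex.ext (by simp) (by simp [him]), fun hre => h0 ?_⟩
  have : a = 0 := Complex.ext (by simp [hre]) (by simp [him])
  rwa [this] at ha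

/-- **Growth from the 2-jet, off the real axis.** For `F` entire of order `< 2`, even, with only
real zeros and `F 0 ≠ 0`, and `Im z ≠ 0`:
`log ‖F z‖ − log ‖F 0‖ ≤ −Re((F′/F)′(0))/2 · ‖z‖²`. -/
theorem log_norm_sub_le_of_im_ne_zero (hF : Differentiable ℂ F) {ρ C : ℝ} (hρ0 : 0 ≤ ρ)
    (hρ : ρ < 2) (hgr : ∀ z, ‖F z‖ ≤ C * Real.exp (‖z‖ ^ ρ)) (heven : ∀ z, F (-z) = F z)
    (hzero : ∀ z, F z = 0 → z.im = 0) (h0 : F 0 ≠ 0) {z : ℂ} (hz : z.im ≠ 0) :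
    Real.log ‖F z‖ - Real.log ‖F 0‖ ≤
      -(deriv (fun w => deriv F w / F w) 0).re / 2 * ‖z‖ ^ 2 := by
  classical
  set Φ : ℂ → ℂ := fun w => deriv F w / F w with hΦ
  -- points of the segment `s • z`, and their negatives, are not zeros
  have hseg : ∀ s : ℝ, F ((s : ℂ) * z) ≠ 0 := by
    intro s hs0
    have him := hzero _ hs0
    have : ((s : ℂ) * z).im = s * z.im := by simp [Complex.mul_im]
    rcases mul_eq_zero.1 (this ▸ him) with h | h
    · apply h0; simpa [h] using hs0
    · exact hz h
  -- oddness of `Φ`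
  have hΦodd : ∀ w, Φ (-w) = -Φ w := fun w => by
    simp only [hΦ, deriv_neg_of_even heven w, heven w, neg_div]
  refine le_of_forall_pos_le_add fun ε hε => ?_
  -- the tolerance
  set ε' : ℝ := ε / (2 * ‖z‖ ^ 2 + 1) with hε'
  have hz2 : 0 ≤ ‖z‖ ^ 2 := by positivity
  have hε'pos : 0 < ε' := by positivity
  have hε'le : 3 / 2 * ε' * ‖z‖ ^ 2 ≤ ε := by
    have e1 : 3 / 2 * ε' * ‖z‖ ^ 2 = ε * (3 / 2 * ‖z‖ ^ 2 / (2 * ‖z‖ ^ 2 + 1)) := by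
      rw [hε']; ring
    have e2 : 3 / 2 * ‖z‖ ^ 2 / (2 * ‖z‖ ^ 2 + 1) ≤ 1 := by
      rw [div_le_one (by positivity)]; nlinarith
    calc 3 / 2 * ε' * ‖z‖ ^ 2 = ε * (3 / 2 * ‖z‖ ^ 2 / (2 * ‖z‖ ^ 2 + 1)) := e1
      _ ≤ ε * 1 := by gcongr
      _ = ε := mul_one ε
  -- choose the radius `R`
  have hCpos : 0 < C := growthConst_pos hgr h0
  have hF0 : 0 < ‖F 0‖ := norm_pos_iff.2 h0
  set K : ℝ := Real.log C - Real.log ‖F 0‖ + 1 with hK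
  have hlim : Tendsto (fun R : ℝ => 64 * ((K + (|(0 : ℝ)| + 2 * R) ^ ρ) / R ^ 2)) atTop (𝓝 0) := by
    simpa using (tendsto_growth_div_sq K 0 hρ0 hρ).const_mul 64
  obtain ⟨R, hRε, hRge⟩ :=
    ((hlim.eventually_lt_const hε'pos).and (eventually_ge_atTop (8 * ‖z‖ + 8))).exists
  simp only [abs_zero, zero_add] at hRε
  have hRpos : 0 < R := by nlinarith [norm_nonneg z]
  have hzR : ‖z‖ ≤ R / 8 := by nlinarith [norm_nonneg z]
  have hzR' : ‖z‖ < R := by nlinarith [norm_nonneg z]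
  -- the bound on `closedBall 0 (2R)` and Titchmarsh's lemma
  set M : ℝ := C * Real.exp ((2 * R) ^ ρ) with hM
  have hMb : ∀ w ∈ closedBall (0 : ℂ) (2 * R), ‖F w‖ ≤ M := by
    intro w hw
    have := norm_le_on_closedBall hρ0 hgr 0 R w (by simpa using hw)
    simpa [hM] using this
  obtain ⟨S, m, ψ, hS, -, hψd, hψeq, -, hψ'⟩ := titchmarsh_logDeriv_sub_sum hF h0 hRpos hMb
  set KR : ℝ := 64 * (Real.log (M / ‖F 0‖) + 1) / R ^ 2 with hKR
  have hlog : Real.log (M / ‖F 0‖) + 1 = K + (2 * R) ^ ρ := by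
    rw [hK, hM, Real.log_div (by positivity) hF0.ne', Real.log_mul hCpos.ne' (Real.exp_pos _).ne',
      Real.log_exp]
    ring
  have hKRε : KR ≤ ε' := by
    rw [hKR, hlog]
    rw [show 64 * (K + (2 * R) ^ ρ) / R ^ 2 = 64 * ((K + (2 * R) ^ ρ) / R ^ 2) by ring]
    exact hRε.le
  have hKR0 : 0 ≤ KR := le_trans (norm_nonneg _) (hψ' 0 (mem_closedBall_self (by positivity)))
  -- the zeros in `S` are non-zero reals
  have hSre : ∀ a ∈ S, a = (a.re : ℂ) ∧ a.re ≠ 0 := fun a ha =>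
    zero_re_ne_zero hzero h0 (hS a ha).1
  -- the odd part of `ψ`
  set ψo : ℂ → ℂ := fun w => (ψ w - ψ (-w)) / 2 with hψo
  have hψo0 : ψo 0 = 0 := by simp [hψo]
  have hball_neg : ∀ {w : ℂ} {r : ℝ}, w ∈ ball (0 : ℂ) r → -w ∈ ball (0 : ℂ) r := by
    intro w r hw; simpa using hw
  have hψoD : ∀ w ∈ closedBall (0 : ℂ) (R / 8),
      HasDerivAt ψo ((deriv ψ w + deriv ψ (-w)) / 2) w := by
    intro w hw
    have hw' : w ∈ ball (0 : ℂ) R := closedBall_subset_ball (by linarith) hw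
    have h1 : HasDerivAt ψ (deriv ψ w) w :=
      (hψd.differentiableAt (isOpen_ball.mem_nhds hw')).hasDerivAt
    have h2 : HasDerivAt ψ (deriv ψ (-w)) (-w) :=
      (hψd.differentiableAt (isOpen_ball.mem_nhds (hball_neg hw'))).hasDerivAt
    have h3 : HasDerivAt (fun w => ψ (-w)) (deriv ψ (-w) * (-1)) w := h2.comp w (hasDerivAt_neg w)
    have h4 : HasDerivAt (fun w => (ψ w - ψ (-w)) / 2) ((deriv ψ w - deriv ψ (-w) * (-1)) / 2) w :=
      (h1.sub h3).div_const 2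
    rwa [show (deriv ψ w - deriv ψ (-w) * (-1)) / 2 = (deriv ψ w + deriv ψ (-w)) / 2 by ring] at h4
  have hψo_bound : ∀ w ∈ closedBall (0 : ℂ) (R / 8), ‖(deriv ψ w + deriv ψ (-w)) / 2‖ ≤ KR := by
    intro w hw
    have hw' : -w ∈ closedBall (0 : ℂ) (R / 8) := by simpa using hw
    have e1 := hψ' w hw
    have e2 := hψ' (-w) hw'
    calc ‖(deriv ψ w + deriv ψ (-w)) / 2‖ = ‖deriv ψ w + deriv ψ (-w)‖ / 2 := by rw [norm_div]; norm_num
      _ ≤ (‖deriv ψ w‖ + ‖deriv ψ (-w)‖) / 2 := by gcongr; exact norm_add_le _ _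
      _ ≤ KR := by linarith
  -- mean value bound for `ψo` from `0`
  have hψo_mv : ∀ w ∈ closedBall (0 : ℂ) (R / 8), ‖ψo w‖ ≤ KR * ‖w‖ := by
    intro w hw
    have := (convex_closedBall (0 : ℂ) (R / 8)).norm_image_sub_le_of_norm_hasDerivWithin_le
      (fun v hv => (hψoD v hv).hasDerivWithinAt) hψo_bound (mem_closedBall_self (by positivity)) hw
    simpa [hψo0] using this
  -- the KEY IDENTITY: the odd part of Titchmarsh's decomposition
  have hkey : ∀ w ∈ ball (0 : ℂ) R, F w ≠ 0 →
      Φ w = ∑ a ∈ S, (m a : ℂ) * w / (w ^ 2 - a ^ 2) + ψo w := by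
    intro w hw hFw
    have hFw' : F (-w) ≠ 0 := by rwa [heven]
    have e1 : ψ w = Φ w - ∑ a ∈ S, (m a : ℂ) / (w - a) := hψeq w hw hFw
    have e2 : ψ (-w) = -Φ w - ∑ a ∈ S, (m a : ℂ) / (-w - a) := by
      rw [hψeq (-w) (hball_neg hw) hFw', ← hΦodd w]
    have e3 : ∑ a ∈ S, (m a : ℂ) / (w - a) - ∑ a ∈ S, (m a : ℂ) / (-w - a)
        = 2 * ∑ a ∈ S, (m a : ℂ) * w / (w ^ 2 - a ^ 2) := by
      rw [← Finset.sum_sub_distrib, Finset.mul_sum]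
      refine Finset.sum_congr rfl fun a ha => ?_
      have hFa : F a = 0 := (hS a ha).1
      have hwa : w - a ≠ 0 := by
        intro h; apply hFw; rw [sub_eq_zero.1 h]; exact hFa
      have hwa' : -w - a ≠ 0 := by
        intro h; apply hFw'; rw [sub_eq_zero.1 h]; exact hFa
      have hwa'' : w + a ≠ 0 := by
        intro h; apply hwa'; linear_combination -h
      have hq : w ^ 2 - a ^ 2 ≠ 0 := by
        rw [sq_sub_sq]; exact mul_ne_zero hwa'' hwa
      field_simp; ring
    linear_combination (-(1 : ℂ) / 2) * e1 + ((1 : ℂ) / 2) * e2 + ((1 : ℂ) / 2) * e3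
  -- the comparison function along the segment
  set G : ℝ → ℝ := fun s => Real.log ‖F ((s : ℂ) * z)‖ -
    ∑ a ∈ S, (m a : ℝ) / 2 * Real.log ‖((s : ℂ) * z) ^ 2 - a ^ 2‖ with hG
  have hsq_ne : ∀ s : ℝ, ∀ a ∈ S, ((s : ℂ) * z) ^ 2 - a ^ 2 ≠ 0 := by
    intro s a ha h
    have hFa : F a = 0 := (hS a ha).1
    rcases (sq_eq_sq_iff_eq_or_eq_neg.1 (sub_eq_zero.1 h)) with h | h
    · exact hseg s (by rw [h]; exact hFa)
    · exact hseg s (by rw [h, heven]; exact hFa)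
  have hsegball : ∀ s ∈ Icc (0 : ℝ) 1, ((s : ℂ) * z) ∈ closedBall (0 : ℂ) (R / 8) := by
    intro s hs
    rw [mem_closedBall, dist_zero_right, norm_mul, Complex.norm_real, Real.norm_eq_abs,
      abs_of_nonneg hs.1]
    nlinarith [hs.2, norm_nonneg z]
  have hGd : ∀ s ∈ Icc (0 : ℝ) 1,
      HasDerivAt G ((z * ψo ((s : ℂ) * z)).re) s := by
    intro s hs
    have d1 := hasDerivAt_log_norm_comp_smul hF z (hseg s)
    have d2 : HasDerivAt (fun s : ℝ => ∑ a ∈ S, (m a : ℝ) / 2 * Real.log ‖((s : ℂ) * z) ^ 2 - a ^ 2‖)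
        (∑ a ∈ S, (((m a : ℝ) : ℂ) * ((s : ℂ) * z ^ 2) / (((s : ℂ) * z) ^ 2 - a ^ 2)).re) s :=
      HasDerivAt.fun_sum fun a ha => hasDerivAt_log_norm_sq_sub z (a ^ 2) (m a) (hsq_ne s a ha)
    have d := d1.sub d2
    refine d.congr_deriv ?_
    have hw : ((s : ℂ) * z) ∈ ball (0 : ℂ) R :=
      closedBall_subset_ball (by linarith) (hsegball s hs)
    have hk := hkey _ hw (hseg s)
    have : z * Φ ((s : ℂ) * z) =
        ∑ a ∈ S, ((m a : ℝ) : ℂ) * ((s : ℂ) * z ^ 2) / (((s : ℂ) * z) ^ 2 - a ^ 2)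
          + z * ψo ((s : ℂ) * z) := by
      rw [hk, mul_add, Finset.mul_sum]
      congr 1
      exact Finset.sum_congr rfl fun a _ => by push_cast; ring
    have hre := congrArg Complex.re this
    rw [Complex.add_re, Complex.re_sum] at hre
    simp only [hΦ] at hre
    linarith
  -- mean value on `[0, 1]`
  have hGmv : ‖G 1 - G 0‖ ≤ ε' * ‖z‖ ^ 2 := by
    refine norm_image_sub_le_of_norm_deriv_le_segment_01'
      (fun s hs => (hGd s hs).hasDerivWithinAt) fun s hs => ?_
    have hs' : s ∈ Icc (0 : ℝ) 1 := Ico_subset_Icc_self hs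
    calc ‖(z * ψo ((s : ℂ) * z)).re‖ ≤ ‖z * ψo ((s : ℂ) * z)‖ := Complex.abs_re_le_norm _
      _ = ‖z‖ * ‖ψo ((s : ℂ) * z)‖ := norm_mul _ _
      _ ≤ ‖z‖ * (KR * ‖(s : ℂ) * z‖) := by gcongr; exact hψo_mv _ (hsegball s hs')
      _ ≤ ‖z‖ * (ε' * ‖z‖) := by
          gcongr ‖z‖ * ?_
          calc KR * ‖(s : ℂ) * z‖ ≤ KR * ‖z‖ := by
                gcongr
                rw [norm_mul, Complex.norm_real, Real.norm_eq_abs, abs_of_nonneg hs.1]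
                nlinarith [hs.2.le, norm_nonneg z]
            _ ≤ ε' * ‖z‖ := by gcongr
      _ = ε' * ‖z‖ ^ 2 := by ring
  -- the pair terms
  have hpair : ∀ a ∈ S, Real.log ‖z ^ 2 - a ^ 2‖ - Real.log ‖(0 : ℂ) ^ 2 - a ^ 2‖ ≤
      ‖z‖ ^ 2 / a.re ^ 2 := by
    intro a ha
    obtain ⟨har, hr⟩ := hSre a ha
    have hr2 : 0 < a.re ^ 2 := by positivity
    have hna : ‖a ^ 2‖ = a.re ^ 2 := by
      rw [har]; simp [Complex.norm_real, sq_abs]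
    have h1 : ‖z ^ 2 - a ^ 2‖ ≤ ‖z‖ ^ 2 + a.re ^ 2 := by
      calc ‖z ^ 2 - a ^ 2‖ ≤ ‖z ^ 2‖ + ‖a ^ 2‖ := norm_sub_le _ _
        _ = ‖z‖ ^ 2 + a.re ^ 2 := by rw [norm_pow, hna]
    have hpos : 0 < ‖z ^ 2 - a ^ 2‖ := by
      have := hsq_ne 1 a ha
      simp only [Complex.ofReal_one, one_mul] at this
      exact norm_pos_iff.2 this
    rw [show ‖(0 : ℂ) ^ 2 - a ^ 2‖ = a.re ^ 2 by simp [hna]]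
    calc Real.log ‖z ^ 2 - a ^ 2‖ - Real.log (a.re ^ 2)
        ≤ Real.log (‖z‖ ^ 2 + a.re ^ 2) - Real.log (a.re ^ 2) := by
          gcongr
      _ = Real.log ((‖z‖ ^ 2 + a.re ^ 2) / a.re ^ 2) := by
          rw [Real.log_div (by positivity) hr2.ne']
      _ ≤ (‖z‖ ^ 2 + a.re ^ 2) / a.re ^ 2 - 1 := Real.log_le_sub_one_of_pos (by positivity)
      _ = ‖z‖ ^ 2 / a.re ^ 2 := by field_simp; ring
  -- the 2-jet identity at `0`
  have hjet : ∑ a ∈ S, (m a : ℝ) / a.re ^ 2 ≤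
      -(deriv Φ 0).re + ε' := by
    -- `Φ` agrees near `0` with the odd decomposition
    have hev : Φ =ᶠ[𝓝 0] fun w => ∑ a ∈ S, (m a : ℂ) * w / (w ^ 2 - a ^ 2) + ψo w := by
      have h1 : ∀ᶠ w in 𝓝 (0 : ℂ), w ∈ ball (0 : ℂ) R := isOpen_ball.mem_nhds (mem_ball_self hRpos)
      have h2 : ∀ᶠ w in 𝓝 (0 : ℂ), F w ≠ 0 := hF.continuous.continuousAt.eventually_ne h0
      filter_upwards [h1, h2] with w hw hFw using hkey w hw hFw
    have hterm : ∀ a ∈ S, HasDerivAt (fun w => (m a : ℂ) * w / (w ^ 2 - a ^ 2))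
        (-(m a : ℂ) / a ^ 2) 0 := by
      intro a ha
      obtain ⟨har, hr⟩ := hSre a ha
      have ha0 : (a : ℂ) ≠ 0 := by rw [har]; exact_mod_cast hr
      have ha2' : a ^ 2 ≠ 0 := pow_ne_zero 2 ha0
      have ha2 : (0 : ℂ) ^ 2 - a ^ 2 ≠ 0 := by
        rw [zero_pow two_ne_zero, zero_sub]; exact neg_ne_zero.2 ha2'
      have hn : HasDerivAt (fun w => (m a : ℂ) * w) ((m a : ℂ) * 1) 0 :=
        (hasDerivAt_id (0 : ℂ)).const_mul _
      have hd : HasDerivAt (fun w => w ^ 2 - a ^ 2) ((2 : ℕ) * (0 : ℂ) ^ (2 - 1)) 0 :=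
        (hasDerivAt_pow 2 (0 : ℂ)).sub_const _
      have hq := hn.div hd ha2
      refine hq.congr_deriv ?_
      rw [div_eq_div_iff (pow_ne_zero 2 ha2) ha2']
      ring
    have hsum : HasDerivAt (fun w => ∑ a ∈ S, (m a : ℂ) * w / (w ^ 2 - a ^ 2))
        (∑ a ∈ S, -(m a : ℂ) / a ^ 2) 0 := HasDerivAt.fun_sum hterm
    have hψo' := hψoD 0 (mem_closedBall_self (by positivity))
    have hderiv : deriv Φ 0 = ∑ a ∈ S, -(m a : ℂ) / a ^ 2 + (deriv ψ 0 + deriv ψ (-0)) / 2 := by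
      rw [hev.deriv_eq]
      exact (hsum.add hψo').deriv
    have hre : (∑ a ∈ S, -(m a : ℂ) / a ^ 2).re = -∑ a ∈ S, (m a : ℝ) / a.re ^ 2 := by
      rw [Complex.re_sum, ← Finset.sum_neg_distrib]
      refine Finset.sum_congr rfl fun a ha => ?_
      obtain ⟨har, -⟩ := hSre a ha
      have ha2 : a ^ 2 = ((a.re ^ 2 : ℝ) : ℂ) := by
        conv_lhs => rw [har]
        push_cast; ring
      rw [ha2, show (-(m a : ℂ)) = ((-(m a : ℝ) : ℝ) : ℂ) by push_cast; ring, ← Complex.ofReal_div,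
        Complex.ofReal_re]
      ring
    have hb := hψo_bound 0 (mem_closedBall_self (by positivity))
    have hb' : ((deriv ψ 0 + deriv ψ (-0)) / 2).re ≤ ε' :=
      ((Complex.re_le_norm _).trans hb).trans hKRε
    have := congrArg Complex.re hderiv
    rw [Complex.add_re, hre] at this
    linarith
  -- assemble
  have hG1 : G 1 - G 0 = (Real.log ‖F z‖ - Real.log ‖F 0‖) -
      ∑ a ∈ S, (m a : ℝ) / 2 * (Real.log ‖z ^ 2 - a ^ 2‖ - Real.log ‖(0 : ℂ) ^ 2 - a ^ 2‖) := by
    simp only [hG, Complex.ofReal_one, one_mul, Complex.ofReal_zero, zero_mul]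
    have : ∑ a ∈ S, (m a : ℝ) / 2 * (Real.log ‖z ^ 2 - a ^ 2‖ - Real.log ‖(0 : ℂ) ^ 2 - a ^ 2‖)
        = ∑ a ∈ S, (m a : ℝ) / 2 * Real.log ‖z ^ 2 - a ^ 2‖
          - ∑ a ∈ S, (m a : ℝ) / 2 * Real.log ‖(0 : ℂ) ^ 2 - a ^ 2‖ := by
      rw [← Finset.sum_sub_distrib]; refine Finset.sum_congr rfl fun a _ => by ring
    rw [this]; ring
  have hsumle : ∑ a ∈ S, (m a : ℝ) / 2 * (Real.log ‖z ^ 2 - a ^ 2‖ - Real.log ‖(0 : ℂ) ^ 2 - a ^ 2‖)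
      ≤ ‖z‖ ^ 2 / 2 * ∑ a ∈ S, (m a : ℝ) / a.re ^ 2 := by
    rw [Finset.mul_sum]
    refine Finset.sum_le_sum fun a ha => ?_
    have hm : (0 : ℝ) ≤ m a := Nat.cast_nonneg _
    calc (m a : ℝ) / 2 * (Real.log ‖z ^ 2 - a ^ 2‖ - Real.log ‖(0 : ℂ) ^ 2 - a ^ 2‖)
        ≤ (m a : ℝ) / 2 * (‖z‖ ^ 2 / a.re ^ 2) := by gcongr; exact hpair a ha
      _ = ‖z‖ ^ 2 / 2 * ((m a : ℝ) / a.re ^ 2) := by ring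
  have habs := (Real.norm_eq_abs _ ▸ hGmv)
  have hG1' : G 1 - G 0 ≤ ε' * ‖z‖ ^ 2 := le_trans (le_abs_self _) habs
  calc Real.log ‖F z‖ - Real.log ‖F 0‖
      = (G 1 - G 0) + ∑ a ∈ S, (m a : ℝ) / 2 *
          (Real.log ‖z ^ 2 - a ^ 2‖ - Real.log ‖(0 : ℂ) ^ 2 - a ^ 2‖) := by rw [hG1]; ring
    _ ≤ ε' * ‖z‖ ^ 2 + ‖z‖ ^ 2 / 2 * ∑ a ∈ S, (m a : ℝ) / a.re ^ 2 := add_le_add hG1' hsumle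
    _ ≤ ε' * ‖z‖ ^ 2 + ‖z‖ ^ 2 / 2 * (-(deriv Φ 0).re + ε') := by gcongr
    _ = -(deriv Φ 0).re / 2 * ‖z‖ ^ 2 + 3 / 2 * ε' * ‖z‖ ^ 2 := by ring
    _ ≤ -(deriv Φ 0).re / 2 * ‖z‖ ^ 2 + ε := by linarith

end Growth

end ThinRigidity

end Summit.RiemannHypothesis.RiemannHypothesis.Theorems
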